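import Summits.ResolutionOfSingularities.ResolutionOfSingularities.Theorems.MarkedTransferCampaignW46MohWindowSurfaceCubeNormalForm
import Mathlib.Algebra.Polynomial.Taylor
import HarnessLib

/-!
# [OURS · L1 W4.6 rung (iii-2), EVERY `p`] Surface Moh window — the SHEAR of a coefficient window presentation and the HEAVY NORMAL FORM
# (heavy root moved to `0`) (cell res-hironaka, LADDER-RESOLUTION rung L, D-0089; seat res-L1-s46-pv-5 gen 5; host MarkedTransfer,
# `--supports stmt-ResolutionOfSingularities-16155 --as helper`; statement file `…CampaignW46MohWindowSurface.lean`)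

HONEST FRAMING. Nothing here is a statement of H. Hironaka's manuscript [Hironaka2017] and nothing here asserts that any
statement of it holds. Pure local-ring / polynomial algebra, the general-`d` analogue of `…CubeNormalForm.lean` (`p = 2`, `d = 3`): the
binomial re-expansion of the coefficient window form `Σ_{k ≤ d} a_k x^{d−k} y^k` in the sheared regular system of parameters
`(x, y − l·x, z)`, whose new residue polynomial is the TAYLOR SHIFT `F(X + λ̄)` of the old one (Mathlib `Polynomial.taylor`); hence a
`κ`-rational root `λ̄` of multiplicity `μ` of `F` (e.g. the HEAVY root of `…HeavyRoot.lean`, `μ ≥ p`) is moved to `0`: the new coefficients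
`a′_0, …, a′_{μ−1}` lie in `𝔪`. With `…StallThreadRoot.lean` (the thread child lies on the exceptional line over the heavy root, for EVERY
presentation) this puts the child of a non-dropping hit at the ORIGIN of the `x`-chart of the sheared presentation — the literal input of a
formal-coordinates entrance door along a heavy thread. AI-written; AI review is weaker than expert review. No `sorry`; axioms standard.

WHAT IS PROVED (namespace `…CampaignW46.MohWindowSurface`).
* `coeffForm_shear_general` — `Σ a_k x^{d−k} (y′ + l x)^k = Σ_j (Σ_k a_k C(k,j) l^{k−j}) x^{d−j} y′^j` (any commutative ring).
* `residue_shearCoeff` — the residues of the sheared coefficients are the coefficients of `taylor λ̄ F`.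
* `exists_heavy_normal_form` — **HEAVY NORMAL FORM**: if `(X − λ̄)^μ ∣ F` then the window form has a presentation `(x, y′, z)`, `y′ = y − l x`,
  with `a′_j ∈ 𝔪` for `j < μ`, a unit among the `a′_j`, the same ring element, and new residue polynomial `taylor λ̄ F` (so `X^μ` divides
  it). [ZariskiSamuel1960] [Matsumura1987]
-/

noncomputable section

set_option linter.dupNamespace false -- mandated namespace of this single-conjunct summit

open IsLocalRing Polynomial

namespace Summit.ResolutionOfSingularities.ResolutionOfSingularities.Theorems

namespace CampaignW46

namespace MohWindowSurface

universe u

/-! ## 1. The shear identity -/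

section Ring

variable {R : Type u} [CommRing R]

/-- **The shear of the coefficient window form** (binomial re-expansion): with the sheared coefficients
`a′_j = Σ_{k ≤ d} a_k · C(k, j) · l^{k−j}`, `Σ_{k ≤ d} a_k x^{d−k} (y′ + l x)^k = Σ_{j ≤ d} a′_j x^{d−j} y′^j`. [folklore] -/
theorem coeffForm_shear_general (a : ℕ → R) (x y' l : R) (d : ℕ) :
    ∑ k ∈ Finset.range (d + 1), a k * x ^ (d - k) * (y' + l * x) ^ k =
      ∑ j ∈ Finset.range (d + 1), (∑ k ∈ Finset.range (d + 1), a k * (k.choose j : R) * l ^ (k - j)) * x ^ (d - j) * y' ^ j := by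
  -- expand `(y' + l x)^k` and collect the monomials `x^{d-j} y'^j`
  have hterm : ∀ k ∈ Finset.range (d + 1), a k * x ^ (d - k) * (y' + l * x) ^ k =
      ∑ j ∈ Finset.range (d + 1), a k * (k.choose j : R) * l ^ (k - j) * x ^ (d - j) * y' ^ j := by
    intro k hk
    have hkd : k ≤ d := Nat.lt_succ_iff.mp (Finset.mem_range.mp hk)
    rw [add_pow, Finset.mul_sum]
    -- the inner sum over `range (k+1)`, term by term
    have hinner : ∀ j ∈ Finset.range (k + 1), a k * x ^ (d - k) * (y' ^ j * (l * x) ^ (k - j) * (k.choose j : R)) =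
        a k * (k.choose j : R) * l ^ (k - j) * x ^ (d - j) * y' ^ j := by
      intro j hj
      have hjk : j ≤ k := Nat.lt_succ_iff.mp (Finset.mem_range.mp hj)
      have hx : x ^ (d - k) * x ^ (k - j) = x ^ (d - j) := by
        rw [← pow_add]; congr 1; omega
      calc a k * x ^ (d - k) * (y' ^ j * (l * x) ^ (k - j) * (k.choose j : R))
          = a k * (k.choose j : R) * l ^ (k - j) * (x ^ (d - k) * x ^ (k - j)) * y' ^ j := by rw [mul_pow]; ring
        _ = a k * (k.choose j : R) * l ^ (k - j) * x ^ (d - j) * y' ^ j := by rw [hx]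
    rw [Finset.sum_congr rfl hinner]
    -- extend the sum from `range (k+1)` to `range (d+1)` (the extra binomials vanish)
    refine Finset.sum_subset (Finset.range_mono (Nat.succ_le_succ hkd)) fun j hj hjk => ?_
    have hkj : k < j := by
      rw [Finset.mem_range] at hj hjk; omega
    rw [Nat.choose_eq_zero_of_lt hkj, Nat.cast_zero, mul_zero, zero_mul, zero_mul, zero_mul]
  rw [Finset.sum_congr rfl hterm, Finset.sum_comm]
  refine Finset.sum_congr rfl fun j _ => ?_
  rw [Finset.sum_mul, Finset.sum_mul]

end Ring

/-! ## 2. Residues of the sheared coefficients: the Taylor shift -/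

section Local

variable {R : Type u} [CommRing R] [IsLocalRing R]

/-- **The residue of the sheared coefficient `a′_j` is the `j`-th coefficient of the Taylor shift `F(X + λ̄)`** of the residue polynomial
`F = Σ_{k ≤ d} ā_k X^k`, `λ̄` the residue of `l`. [folklore] -/
theorem residue_shearCoeff (a : ℕ → R) (l : R) (d j : ℕ) :
    residue R (∑ k ∈ Finset.range (d + 1), a k * (k.choose j : R) * l ^ (k - j)) =
      (taylor (residue R l) (∑ k ∈ Finset.range (d + 1), C (residue R (a k)) * X ^ k)).coeff j := by
  rw [taylor_coeff, map_sum, map_sum, eval_finsetSum]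
  refine Finset.sum_congr rfl fun k _ => ?_
  rw [C_mul_X_pow_eq_monomial, hasseDeriv_monomial, eval_monomial, map_mul, map_mul, map_pow, map_natCast]
  ring

/-- **[OURS · L1 W4.6 rung (iii-2)] THE HEAVY NORMAL FORM.** In a local ring `R` with `(x, y, z) = 𝔪`, let `Σ_{k ≤ d} a_k x^{d−k} y^k` have a unit
among its coefficients and let `λ̄ = residue l` be a root of multiplicity `≥ μ` of the residue polynomial `F = Σ ā_k X^k`
(`(X − C λ̄)^μ ∣ F`). Then with `y′ = y − l·x` — again `(x, y′, z) = 𝔪` — and the sheared coefficients `a′`: the SAME ring element is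
`Σ a′_j x^{d−j} y′^j`, some `a′_j` (`j ≤ d`) is a unit, `a′_j ∈ 𝔪` for all `j < μ`, and the new residue polynomial `Σ ā′_j X^j` is
`taylor λ̄ F = F(X + λ̄)` (so `X^μ` divides it: the root has moved to `0`). NOT a statement of the manuscript. [folklore] -/
theorem exists_heavy_normal_form {x y z : R} (hxyz : Ideal.span {x, y, z} = maximalIdeal R) (a : ℕ → R) {d : ℕ}
    (hunit : ∃ k ≤ d, IsUnit (a k)) (l : R) {μ : ℕ}
    (hdvd : (X - C (residue R l)) ^ μ ∣ ∑ k ∈ Finset.range (d + 1), C (residue R (a k)) * X ^ k) :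
    ∃ (y' : R) (a' : ℕ → R), Ideal.span {x, y', z} = maximalIdeal R ∧ (∃ j ≤ d, IsUnit (a' j)) ∧ (∀ j < μ, a' j ∈ maximalIdeal R) ∧
      ∑ k ∈ Finset.range (d + 1), a k * x ^ (d - k) * y ^ k = ∑ j ∈ Finset.range (d + 1), a' j * x ^ (d - j) * y' ^ j ∧
      (∑ j ∈ Finset.range (d + 1), C (residue R (a' j)) * X ^ j) =
        taylor (residue R l) (∑ k ∈ Finset.range (d + 1), C (residue R (a k)) * X ^ k) := by
  classical
  set F : (ResidueField R)[X] := ∑ k ∈ Finset.range (d + 1), C (residue R (a k)) * X ^ k with hF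
  set a' : ℕ → R := fun j => ∑ k ∈ Finset.range (d + 1), a k * (k.choose j : R) * l ^ (k - j) with ha'
  have hres : ∀ j, residue R (a' j) = (taylor (residue R l) F).coeff j := fun j => residue_shearCoeff a l d j
  -- `F ≠ 0` of degree `≤ d`, hence so is its Taylor shift
  have hcoeffF : ∀ n ≤ d, F.coeff n = residue R (a n) := by
    intro n hn
    rw [hF, finsetSum_coeff]
    simp only [coeff_C_mul_X_pow]
    rw [Finset.sum_eq_single n]
    · rw [if_pos rfl]
    · intro k _ hk; rw [if_neg (Ne.symm hk)]
    · intro h; exact absurd (Finset.mem_range.mpr (Nat.lt_succ_of_le hn)) h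
  have hF0 : F ≠ 0 := by
    obtain ⟨k₀, hk₀, hk₀u⟩ := hunit
    intro h
    have := hcoeffF k₀ hk₀
    rw [h, coeff_zero] at this
    exact (residue_ne_zero_iff_isUnit _).mpr hk₀u this.symm
  have hFdeg : F.natDegree ≤ d :=
    natDegree_sum_le_of_forall_le _ _ fun k hk =>
      (natDegree_C_mul_X_pow_le (residue R (a k)) k).trans (Nat.lt_succ_iff.mp (Finset.mem_range.mp hk))
  have hT0 : taylor (residue R l) F ≠ 0 := fun h => hF0 ((taylor_eq_zero _ _).mp h)
  have hTdeg : (taylor (residue R l) F).natDegree ≤ d := by rw [natDegree_taylor]; exact hFdeg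
  -- `X^μ ∣ taylor λ̄ F`
  have hXμ : X ^ μ ∣ taylor (residue R l) F := by
    obtain ⟨G, hG⟩ := hdvd
    refine ⟨taylor (residue R l) G, ?_⟩
    rw [show F = (X - C (residue R l)) ^ μ * G from hG, taylor_mul, taylor_pow, map_sub, taylor_X, taylor_C, add_sub_cancel_right]
  refine ⟨y - l * x, a', by rw [span_triple_sub_mul_eq, hxyz], ?_, ?_, ?_, ?_⟩
  · -- a unit among the new coefficients: the leading coefficient of the Taylor shift
    refine ⟨(taylor (residue R l) F).natDegree, hTdeg, ?_⟩
    refine (residue_ne_zero_iff_isUnit _).mp ?_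
    rw [hres]
    exact fun h => hT0 (leadingCoeff_eq_zero.mp h)
  · intro j hj
    rw [← residue_eq_zero_iff, hres]
    exact (X_pow_dvd_iff.mp hXμ) j hj
  · have h := coeffForm_shear_general a x (y - l * x) l d
    rw [sub_add_cancel] at h
    exact h
  · -- the new residue polynomial IS the Taylor shift (equal coefficients, both of degree `≤ d`)
    apply Polynomial.ext
    intro n
    rw [finsetSum_coeff]
    simp only [coeff_C_mul_X_pow]
    by_cases hn : n ≤ d
    · rw [Finset.sum_eq_single n, if_pos rfl, hres]
      · intro k _ hk; rw [if_neg (Ne.symm hk)]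
      · intro h; exact absurd (Finset.mem_range.mpr (Nat.lt_succ_of_le hn)) h
    · rw [Finset.sum_eq_zero fun k hk => ?_, eq_comm]
      · exact coeff_eq_zero_of_natDegree_lt (by omega)
      · rw [if_neg]
        intro h; subst h
        exact hn (Nat.lt_succ_iff.mp (Finset.mem_range.mp hk))

end Local

end MohWindowSurface

end CampaignW46

end Summit.ResolutionOfSingularities.ResolutionOfSingularities.Theorems

end
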